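import Literature.AlgebraicGeometry.HodgeTheory.CorrespondenceComposition
import Literature.AlgebraicGeometry.HodgeTheory.GysinBaseChange
import Literature.AlgebraicGeometry.HodgeTheory.ComplexGysinCorrespondence
import Literature.AlgebraicGeometry.HodgeTheory.MotivatedClassesProofs
import Literature.AlgebraicGeometry.HodgeTheory.CorrespondenceCupProductIdentities
import Summits.HodgeConjecture.HodgeConjecture.Theorems.EndoscopicMiddleDegreeCupProductAlgebraic
import HarnessLib

/-!
# Ring 2 · sub-cell AbelianAll, André axis, part XXII-b — TOWARDS LIEBERMAN'S `B(A)` ON THE REAL CARRIERS: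
# the algebra of correspondence actions `γ_* = pr_{1*}(pr_2^*(·) ∪ γ)` — composition, Lefschetz twists,
# linear combinations, powers

HONEST FRAMING (page 1, verbatim): **research route, not a corollary; conditional on HC_CM plus one named
minimal statement.** Cell line: research route conditional on HC_CM; not a corollary; Q11.4-sentence-2
already refuted in dim ≥ 3. Nothing in this file proves a case of the Hodge conjecture; `HC_CM` does not occur.
Seat `pub-hodge-ring2-ab-andre-2`, gen 14. Part XXII-a gave a bijective algebraic correspondence
`F : H^j(A(ℂ)) → H^i(A(ℂ))`; part XXII-c inverts the hard-Lefschetz isomorphisms by Cayley–Hamilton in the algebra of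
algebraic correspondences (Kleiman 1968, 2A11). This part is that algebra, for the tree's CONSTRUCTED action
`corrAction μ hW hX hab γ` (`HodgeTheory/ComplexGysinCorrespondence`, any orientation family `μ`), on arbitrary smooth
projective complex varieties — everything stated as "there is an ALGEBRAIC class whose action is …":

* §0 degree bookkeeping (`complexGysin_cupProduct_congr`);
* §1 **composition** `corrAction_comp`: `[γ]_* ∘ [γ']_* = [γ'']_*` with `γ'' = c • p₁₃_*(p₁₂^*γ ∪ p₂₃^*γ')` ALGEBRAIC —
  the tree's `corr_comp_of_baseChange` (Fulton 16.1.1) with its two hypotheses DISCHARGED: Gysin base change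
  `gysin_baseChange` (`GysinBaseChange`) and the multiplicativity of algebraic classes
  `Voisin2003_cupProduct_algebraicClasses_holds` (Theorems), fed to `corrCompClass_mem_algebraicClasses` (Buskin 6.3);
* §2 **Lefschetz twists** `corrAction_comp_lefschetzOperator` / `corrAction_comp_lefschetzPow`: `[γ]_* ∘ Lʳ_η = [γ ∪ pr_2^* ηʳ]_*`
  for an algebraic `η ∈ N¹ H²(X(ℂ))`;
* §3 **linear combinations** `corrAction_sum_smul`; §4 **powers** `exists_corrAction_eq_pow_comp`: for algebraic
  endo-correspondences `w = [γ_w]_*` of `Hᵇ(X(ℂ))` and `F = [γ_F]_* : Hᵃ(Y(ℂ)) → Hᵇ(X(ℂ))`, every `wᵏ ∘ F` is `[γ_k]_*`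
  with `γ_k` algebraic; `exists_corrAction_eq_aeval_comp` for polynomials in `w`.

## What is proved (theorems only; no definition, no named fact, no sorry)

EDGE LABELS: all K (kernel). References: Fulton1998 (§16.1 Def. 16.1.1–2, Prop. 16.1.1; Prop. 1.7);
Buskin2019 (Lemma 6.3); VoisinHodgeII2003 (§9.2.4 Prop. 9.20–9.21, proof of Thm. 10.17 (10.7));
Kleiman1968AlgebraicCycles (§1.3, App. to §2 2A11); FultonYoungTableaux1997 (App. B §B.1 (3), (5), (6));
HatcherAT2002 (§3.2 Prop. 3.10, Thm. 3.11).
-/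

noncomputable section

set_option linter.dupNamespace false

namespace Summit.HodgeConjecture.HodgeConjecture.Ring2.AbelianAll

open CategoryTheory AlgebraicGeometry MonoidalCategory CartesianMonoidalCategory
open Literature.AlgebraicGeometry Literature.AlgebraicGeometry.Motives
open Literature.AlgebraicGeometry.HodgeTheory
open Literature.AlgebraicTopology.SingularHomology (singularCohomology cupProduct cupProduct_assoc
  cupProduct_gradedComm_holds)
open Literature.Geometry.Kaehler (lefschetzOperator lefschetzPow lefschetzOperator_apply lefschetzPow_zero
  lefschetzPow_succ)

variable (μ : OrientationFamily) {l m n : ℕ} {W X Y Z : SchemeOver ℂ}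

/-! ## §0 Degree bookkeeping -/

/-- The Gysin image of a cup product does not depend on the spelling of its degree. [folklore] -/
theorem complexGysin_cupProduct_congr {T : SchemeOver ℂ} (hT : IsSmoothProjective l T) (hW : IsSmoothProjective m W)
    (f : T ⟶ W) {p q k₁ k₂ b : ℕ} (h₁ : p + q = k₁) (h₂ : p + q = k₂) (d₁ : k₁ + 2 * m = b + 2 * l)
    (d₂ : k₂ + 2 * m = b + 2 * l) (y : complexBetti T p) (z : complexBetti T q) :
    complexGysin μ hT hW f d₁ (cupProduct h₁ y z) = complexGysin μ hT hW f d₂ (cupProduct h₂ y z) := by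
  subst h₁; subst h₂; rfl

/-! ## §1 Composition of algebraic correspondences is an algebraic correspondence -/

/-- **Composition.** For smooth projective `X, Y, Z` (dimensions `l, m, n`) and ALGEBRAIC classes
`γ ∈ Nᵉ H^{2e}((X ⊗ Y)(ℂ))`, `γ' ∈ Nᵉ' H^{2e'}((Y ⊗ Z)(ℂ))` with `e + e' = e'' + m`, there is an ALGEBRAIC
`γ'' ∈ Nᵉ'' H^{2e''}((X ⊗ Z)(ℂ))` with `[γ'']_* = [γ]_* ∘ [γ']_*` on `Hᵃ(Z(ℂ); ℂ)` — namely
`γ'' = c • p₁₃_*(p₁₂^* γ ∪ p₂₃^* γ')` (Fulton Def. 16.1.1 / Prop. 16.1.1: the tree's `corr_comp_of_baseChange`, whose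
base-change hypothesis is the tree's theorem `gysin_baseChange` and whose moving-lemma hypothesis is the tree's theorem
`Voisin2003_cupProduct_algebraicClasses_holds`, through `corrCompClass_mem_algebraicClasses`, Buskin Lemma 6.3).
[cite: Fulton1998, §16.1 Def. 16.1.1 and Prop. 16.1.1] [cite: Buskin2019, Lemma 6.3] [cite: VoisinHodgeII2003, §9.2.4 Prop. 9.20] -/
theorem corrAction_comp (hX : IsSmoothProjective l X) (hY : IsSmoothProjective m Y) (hZ : IsSmoothProjective n Z)
    {e e' e'' a a₁ a₂ : ℕ} (he : e + e' = e'' + m) (h₁ : a + 2 * e' = a₁ + 2 * n) (h₂ : a₁ + 2 * e = a₂ + 2 * m)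
    (h₃ : a + 2 * e'' = a₂ + 2 * n)
    {γ : complexBetti (X ⊗ Y) (2 * e)} (hγ : γ ∈ algebraicClasses (X ⊗ Y) e)
    {γ' : complexBetti (Y ⊗ Z) (2 * e')} (hγ' : γ' ∈ algebraicClasses (Y ⊗ Z) e') :
    ∃ γ'' ∈ algebraicClasses (X ⊗ Z) e'',
      corrAction μ hX hZ h₃ γ'' = corrAction μ hX hY h₂ γ ∘ₗ corrAction μ hY hZ h₁ γ' := by
  have hμ : μ.HasPoincareDuality := OrientationFamily.hasPoincareDuality μ
  obtain ⟨c, hc⟩ := gysin_baseChange μ hX hY hZ (k := a + 2 * e') (k₁ := a₁)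
    (show a + 2 * e' + 2 * m = a₁ + 2 * (m + n) by omega)
  have hT := hX.tensor_holds (hY.tensor_holds hZ)
  refine ⟨c • complexGysin μ hT (hX.tensor_holds hZ) (X ◁ snd Y Z)
      (show 2 * (e + e') + 2 * (l + n) = 2 * e'' + 2 * (l + (m + n)) by omega)
      (cupProduct ((Nat.mul_add 2 e e').symm : 2 * e + 2 * e' = 2 * (e + e'))
        (complexBetti.map (X ◁ fst Y Z) (2 * e) γ) (complexBetti.map (snd X (Y ⊗ Z)) (2 * e') γ')),
    Submodule.smul_mem _ _ (corrCompClass_mem_algebraicClasses hμ hX hY hZ he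
      (fun a ha b hb ↦ Summit.HodgeConjecture.HodgeConjecture.Theorems.Voisin2003_cupProduct_algebraicClasses_holds hT
        ha hb) hγ hγ'), ?_⟩
  refine LinearMap.ext fun y ↦ ?_
  rw [LinearMap.comp_apply, corrAction_apply, corrAction_apply, corrAction_apply]
  exact corr_comp_of_baseChange hμ hX hY hZ h₁ h₂ (show 2 * e + 2 * e' = 2 * e'' + 2 * m by omega)
    ((Nat.mul_add 2 e e').symm) γ γ' c hc y

/-! ## §2 Lefschetz twists: `[γ]_* ∘ L_η = [pr_2^* η ∪ γ]_*` -/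

/-- **One Lefschetz twist.** For `η ∈ N¹ H²(X(ℂ))` algebraic and `γ ∈ Nᵉ H^{2e}((W ⊗ X)(ℂ))` algebraic, the composite of
`[γ]_* : H^{a₂}(X(ℂ)) → Hᵇ(W(ℂ))` with the Lefschetz operator `L_η : H^{a₁}(X(ℂ)) → H^{a₂}(X(ℂ))` (`2 + a₁ = a₂`) is
`[pr_X^* η ∪ γ]_*`, an algebraic correspondence of codimension `e + 1`:
`pr_{W*}(pr_X^*(η ∪ x) ∪ γ) = pr_{W*}(pr_X^* x ∪ (pr_X^* η ∪ γ))` (Hatcher 3.10–3.11; Voisin II Prop. 9.20 for the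
algebraicity of the cup product, the tree's theorem `Voisin2003_cupProduct_algebraicClasses_holds`).
[cite: VoisinHodgeII2003, §9.2.4 Prop. 9.20 and proof of Thm. 10.17 (10.7)] [cite: HatcherAT2002, §3.2 Prop. 3.10 and Thm. 3.11] -/
theorem corrAction_comp_lefschetzOperator (hW : IsSmoothProjective m W) (hX : IsSmoothProjective n X)
    {η : complexBetti X 2} (hη : η ∈ algebraicClasses X 1) {e a₁ a₂ b : ℕ} (h12 : 2 + a₁ = a₂)
    (hab : a₂ + 2 * e = b + 2 * n) (hab₁ : a₁ + 2 * (e + 1) = b + 2 * n)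
    {γ : complexBetti (W ⊗ X) (2 * e)} (hγ : γ ∈ algebraicClasses (W ⊗ X) e) :
    ∃ γ₁ ∈ algebraicClasses (W ⊗ X) (e + 1), ∀ x : complexBetti X a₁,
      corrAction μ hW hX hab₁ γ₁ x = corrAction μ hW hX hab γ (lefschetzOperator η h12 x) := by
  have hWX := hW.tensor_holds hX
  -- `γ₁ = pr_X^* η ∪ γ`
  have hηWX : complexBetti.map (snd W X) 2 η ∈ algebraicClasses (W ⊗ X) 1 :=
    map_snd_mem_supportedClasses hW hX (a := 2 * 1) hη
  have hγ₁ : cupProduct (show 2 * 1 + 2 * e = 2 * (e + 1) by omega) (complexBetti.map (snd W X) 2 η) γ ∈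
      algebraicClasses (W ⊗ X) (e + 1) := by
    have h := Summit.HodgeConjecture.HodgeConjecture.Theorems.Voisin2003_cupProduct_algebraicClasses_holds hWX hηWX hγ
    exact (cupProduct_mem_supportedClasses_congr (two_mul_add_two_mul 1 e) (show 2 * 1 + 2 * e = 2 * (e + 1) by omega)
      (Nat.add_comm 1 e) _ _).1 h
  refine ⟨_, hγ₁, fun x ↦ ?_⟩
  rw [corrAction_apply, corrAction_apply, lefschetzOperator_apply, complexBetti.map_cupProduct]
  -- `pr_X^* η ∪ pr_X^* x = pr_X^* x ∪ pr_X^* η` (degree `2` is even)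
  rw [cupProduct_gradedComm_holds ℂ _ h12 (show a₁ + 2 = a₂ by omega) (complexBetti.map (snd W X) 2 η)
    (complexBetti.map (snd W X) a₁ x)]
  have heven : ((-1 : ℂ) ^ (2 * a₁)) = 1 := by rw [pow_mul, neg_one_sq, one_pow]
  rw [heven, one_smul]
  -- reassociate: `(pr_X^* x ∪ pr_X^* η) ∪ γ = pr_X^* x ∪ (pr_X^* η ∪ γ)`, then re-spell the degree of the Gysin source
  rw [cupProduct_assoc (show a₁ + 2 = a₂ by omega) (show 2 * 1 + 2 * e = 2 * (e + 1) by omega) rfl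
    (show a₁ + 2 * (e + 1) = a₂ + 2 * e by omega)]
  exact complexGysin_cupProduct_congr μ hWX hW (fst W X) rfl _ _ _ _ _

/-- **Iterated Lefschetz twist.** For `η ∈ N¹ H²(X(ℂ))` and `γ ∈ Nᵉ H^{2e}((W ⊗ X)(ℂ))` algebraic and every `r`:
the composite of `[γ]_* : H^{a + 2r}(X(ℂ)) → Hᵇ(W(ℂ))` with `Lʳ_η : Hᵃ(X(ℂ)) → H^{a+2r}(X(ℂ))` is `[γ']_*` for an algebraic
`γ'` of codimension `e'`, `e + r = e'` (namely `pr_X^* ηʳ ∪ γ`). [cite: VoisinHodgeII2003, §9.2.4 Prop. 9.20 and proof of Thm. 10.17 (10.7)] -/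
theorem corrAction_comp_lefschetzPow (hW : IsSmoothProjective m W) (hX : IsSmoothProjective n X)
    {η : complexBetti X 2} (hη : η ∈ algebraicClasses X 1) (a : ℕ) :
    ∀ (r : ℕ) {e e' b : ℕ} (_he : e + r = e') (hab : a + 2 * r + 2 * e = b + 2 * n) (hab' : a + 2 * e' = b + 2 * n)
      {γ : complexBetti (W ⊗ X) (2 * e)} (_hγ : γ ∈ algebraicClasses (W ⊗ X) e),
      ∃ γ' ∈ algebraicClasses (W ⊗ X) e', ∀ x : complexBetti X a,
        corrAction μ hW hX hab' γ' x = corrAction μ hW hX hab γ (lefschetzPow η r a x)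
  | 0, e, e', b, he, hab, hab', γ, hγ => by
    obtain rfl : e = e' := by omega
    exact ⟨γ, hγ, fun x ↦ by rw [lefschetzPow_zero, LinearMap.id_apply]⟩
  | r + 1, e, e', b, he, hab, hab', γ, hγ => by
    -- peel off the outermost `L`: `[γ]_* ∘ L^{r+1} = ([γ]_* ∘ L) ∘ Lʳ`
    obtain ⟨γ₁, hγ₁, h₁⟩ := corrAction_comp_lefschetzOperator μ hW hX hη
      (show 2 + (a + 2 * r) = a + 2 * (r + 1) by omega) hab (show a + 2 * r + 2 * (e + 1) = b + 2 * n by omega) hγ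
    obtain ⟨γ', hγ', h'⟩ := corrAction_comp_lefschetzPow hW hX hη a r (show e + 1 + r = e' by omega)
      (show a + 2 * r + 2 * (e + 1) = b + 2 * n by omega) hab' hγ₁
    refine ⟨γ', hγ', fun x ↦ ?_⟩
    rw [h', lefschetzPow_succ, LinearMap.comp_apply, h₁]

/-! ## §3 Linear combinations -/

/-- **Linear combinations of correspondence actions with a common degree are correspondence actions of the linear
combination of the classes** (`corrAction` is linear in the class), and the combination of algebraic classes is
algebraic. [cite: VoisinHodgeII2003, proof of Thm. 10.17 (10.7)] -/
theorem corrAction_sum_smul (hW : IsSmoothProjective m W) (hX : IsSmoothProjective n X) {e a b : ℕ}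
    (hab : a + 2 * e = b + 2 * n) {ι : Type*} (s : Finset ι) (d : ι → ℂ)
    (γ : ι → complexBetti (W ⊗ X) (2 * e)) (hγ : ∀ k ∈ s, γ k ∈ algebraicClasses (W ⊗ X) e) :
    (∑ k ∈ s, d k • γ k) ∈ algebraicClasses (W ⊗ X) e ∧
      corrAction μ hW hX hab (∑ k ∈ s, d k • γ k) = ∑ k ∈ s, d k • corrAction μ hW hX hab (γ k) := by
  refine ⟨Submodule.sum_mem _ fun k hk ↦ Submodule.smul_mem _ _ (hγ k hk), ?_⟩
  rw [map_sum]
  exact Finset.sum_congr rfl fun k _ ↦ by rw [map_smul]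

/-! ## §4 Powers of an algebraic endo-correspondence composed with an algebraic correspondence -/

/-- **`wᵏ ∘ F` is an algebraic correspondence.** For smooth projective `X`, `Y` (dimensions `m`, `n`), an algebraic
endo-correspondence `w = [γ_w]_*` of `Hᵇ(X(ℂ); ℂ)` (`γ_w ∈ Nᵐ H^{2m}((X ⊗ X)(ℂ))`) and an algebraic correspondence
`F = [γ_F]_* : Hᵃ(Y(ℂ)) → Hᵇ(X(ℂ))` (`γ_F ∈ Nᵉ`), every `wᵏ ∘ F` is `[γ_k]_*` with `γ_k ∈ Nᵉ H^{2e}((X ⊗ Y)(ℂ))` algebraic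
(induction on `k`, §1). [cite: Fulton1998, §16.1 Prop. 16.1.1] [cite: Kleiman1968AlgebraicCycles, §1.3 and Appendix to §2, 2A11] -/
theorem exists_corrAction_eq_pow_comp (hX : IsSmoothProjective m X) (hY : IsSmoothProjective n Y) {e a b : ℕ}
    (habF : a + 2 * e = b + 2 * n) (habw : b + 2 * m = b + 2 * m)
    {γF : complexBetti (X ⊗ Y) (2 * e)} (hγF : γF ∈ algebraicClasses (X ⊗ Y) e)
    {γw : complexBetti (X ⊗ X) (2 * m)} (hγw : γw ∈ algebraicClasses (X ⊗ X) m) :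
    ∀ k : ℕ, ∃ γk ∈ algebraicClasses (X ⊗ Y) e,
      corrAction μ hX hY habF γk = ((corrAction μ hX hX habw γw) ^ k) ∘ₗ corrAction μ hX hY habF γF
  | 0 => ⟨γF, hγF, by rw [pow_zero, Module.End.one_eq_id, LinearMap.id_comp]⟩
  | k + 1 => by
    obtain ⟨γk, hγk, hk⟩ := exists_corrAction_eq_pow_comp hX hY habF habw hγF hγw k
    obtain ⟨γ'', hγ'', h''⟩ := corrAction_comp μ hX hX hY (e := m) (e' := e) (e'' := e) (by omega) habF habw habF
      hγw hγk
    refine ⟨γ'', hγ'', ?_⟩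
    rw [h'', hk, pow_succ', Module.End.mul_eq_comp, LinearMap.comp_assoc]

/-- **Polynomials in an algebraic endo-correspondence, composed with an algebraic correspondence, are algebraic
correspondences**: with `w`, `F` as above and any finitely supported coefficients `d`, `(Σ_k d_k wᵏ) ∘ F = [γ]_*` for an
algebraic `γ ∈ Nᵉ H^{2e}((X ⊗ Y)(ℂ))`. [cite: Kleiman1968AlgebraicCycles, Appendix to §2, 2A11] -/
theorem exists_corrAction_eq_sum_pow_comp (hX : IsSmoothProjective m X) (hY : IsSmoothProjective n Y) {e a b : ℕ}
    (habF : a + 2 * e = b + 2 * n) (habw : b + 2 * m = b + 2 * m)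
    {γF : complexBetti (X ⊗ Y) (2 * e)} (hγF : γF ∈ algebraicClasses (X ⊗ Y) e)
    {γw : complexBetti (X ⊗ X) (2 * m)} (hγw : γw ∈ algebraicClasses (X ⊗ X) m) (s : Finset ℕ) (d : ℕ → ℂ) :
    ∃ γ ∈ algebraicClasses (X ⊗ Y) e,
      corrAction μ hX hY habF γ =
        (∑ k ∈ s, d k • (corrAction μ hX hX habw γw) ^ k) ∘ₗ corrAction μ hX hY habF γF := by
  classical
  choose γk hγk hk using exists_corrAction_eq_pow_comp μ hX hY habF habw hγF hγw
  obtain ⟨hmem, hsum⟩ := corrAction_sum_smul μ hX hY habF s d γk (fun k _ ↦ hγk k)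
  refine ⟨_, hmem, ?_⟩
  rw [hsum]
  refine LinearMap.ext fun y ↦ ?_
  simp only [LinearMap.sum_apply, LinearMap.comp_apply, LinearMap.smul_apply, hk]

end Summit.HodgeConjecture.HodgeConjecture.Ring2.AbelianAll

end
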